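import Summits.BirchSwinnertonDyer.Rank1Residual.Partition.Bsdp
import Summits.BirchSwinnertonDyer.Rank1Residual.X11a.RankZeroHeightFree
import Summits.BirchSwinnertonDyer.BirchSwinnertonDyer.Theorems.Rank1ResidualX1Defs
import Literature.NumberTheory.EllipticCurves.LeadingTermPPartProofs
import Literature.NumberTheory.EllipticCurves.Rank1Residual.X9NoEntry
import Literature.NumberTheory.EllipticCurves.Rank1Residual.PeriodUnitProofs
import Literature.NumberTheory.EllipticCurves.Rank1Residual.PPartGoodOrdinarySurj
import Literature.NumberTheory.EllipticCurves.Rank1Residual.X1MainConjecture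
import Literature.NumberTheory.EllipticCurves.Wuthrich2014.ThreeAdicImage
import Literature.NumberTheory.EllipticCurves.Wuthrich2014.RankOneConverseProofs
import Literature.NumberTheory.EllipticCurves.Wuthrich2014.RankOneConverseOddPrimeProofs
import Literature.NumberTheory.EllipticCurves.SupersingularIrreducibleProofs
import HarnessLib

/-!
# The covered rows at MAIN-CONJECTURE level: `(main conjecture, as typed) + (control theorems, as
# typed) ⇒ BSD(E,p)` — the implication skeletons, every hypothesis explicit (cell `b2b-bsdres`, GLUE seat)

HONEST FRAMING (cell `b2b-bsdres`, run/shared/lean/b2b/bsd-rank1-residual/, verbatim in every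
file): the goal of the cell is to DELETE the COMBINATION-SHAPED residual classes of the
Birch–Swinnerton-Dyer formula for ALL analytic-rank `≤ 1` elliptic curves over `ℚ` — "full BSD
formula for every rank `≤ 1` curve in class `C`" assembled STRICTLY from published theorems — so
that the rank-`≤ 1` remainder becomes exactly the CONSTRUCTION-SHAPED classes, which are TYPED
(missing-input `Prop`s), NOT attempted. This is not "finishing BSD". This file is NEW WORK of the
cell (bookkeeping over decls already in the tree), hence under `Summits/`; it introduces NO named
fact and NO definition: every published theorem enters as an explicit hypothesis — one of the tree's
existing NAMED FACTS (D-0014) — and every unproved main conjecture enters as the tree's existing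
`@[conjecture]` predicate (`MazurMainConjecture W p`, `X2.MazurMainConjectureAt W p`), never as a fact.

## What this adds to `Partition/Bsdp.lean`

`Partition/Bsdp.lean` binds each covered row C1, C2, …, C17 of RESIDUAL-CASES §a.1 to `BSDp W p`
through the named fact transcribing the row's PRINTED `p`-PART THEOREM (e.g. Skinner 2016 Thm. C).
Those printed theorems are themselves one-paragraph deductions "Iwasawa main conjecture + control /
Euler-characteristic theorem + interpolation ⇒ `p`-part of BSD". This file records those deductions
as kernel objects ONE LEVEL DEEPER, so that a 'covered by theorem X' row can point at
`(main conjecture for (E,p), as the tree types it) + (control theorems, as the tree types them) ⇒ BSD(E,p)`: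

| skeleton / row | main-conjecture input (typed) | control / leading-term inputs (typed named facts) | theorem here |
|---|---|---|---|
| good ordinary odd `p`, `r = 0`, ANY image | `MazurMainConjecture W p` (Rank1ResidualX1Defs; `@[conjecture]`) | Greenberg 1999 Thm. 4.1 `greenberg_charValue_rankZero`; Mazur–SwD interpolation (tree theorem); modularity; GZK | `bsdp_of_mazurMainConjecture_of_analyticRank_eq_zero` |
| good ordinary `p ≥ 5` / odd `p`, `r = 1`, ANY image, MODULO the Schneider certificate | `MazurMainConjecture W p` | Perrin-Riou–Schneider leading term `Schneider1985_order_charGenerator[_odd]`; Perrin-Riou 1987 `perrinRiou_rankOne_leadingTerms[_odd]`; Mazur–Tate σ `mazur_tate_sigma_exists_odd`; modularity; GZK | `bsdp_of_mazurMainConjecture_of_analyticRank_eq_one_of_schneider[_odd]`, `…_le_one_of_schneider` |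
| multiplicative odd `p`, `r = 0`, ANY image | `X2.MazurMainConjectureAt W p` (X2/Cells; = conclusion shape of Skinner 2016 Thm. A) | Jones 1989 = Stein–Wuthrich 2013 Thm. 6.1 `thm61_{split,nonsplit}Multiplicative`; Greenberg–Stevens `greenberg_stevens`; `𝓛_p ≠ 0` (tree theorem); modularity; GZK | (x11a) `X2.bsdp_of_mazurMainConjectureAt_of_analyticRank_eq_zero_heightFree` — re-used |
| **C1** (Skinner 2016 Thm. C: `r = 0`, `p ≥ 3`, ord ∨ mult, irr, ram) | Skinner–Urban 2014 Thm. 3.6.9 `skinner_urban_main_conjecture` (bsd.S21, clause 3; surjectivity ⇐ irr + ram, `surj_of_irr_of_ram`) at good `p`; Skinner 2016 Thm. A `Skinner2016.thmA_charIdeal_multiplicative` at `p ‖ N` | Greenberg Thm. 4.1; Wuthrich 2014 Lemma 20 (`p = 3`); period unit `realPeriodRat_eq_unit_mul_plusPeriod[_three]`; Stein–Wuthrich Thm. 6.1; Greenberg–Stevens; modularity; GZK | `RowC1.bsdp_of_mainConjectures` |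
| C1 good locus, the typed MC itself | `MazurMainConjecture W p` is a THEOREM there: `mazurMainConjecture_of_skinnerUrban` (S–U clause 3 + Serre / Wuthrich L20 + period unit) | — | `mazurMainConjecture_of_skinnerUrban` |
| **C7** (GV chain) | Greenberg–Vatsal 2000 Thm. 1.3 `GreenbergVatsal2000.thm13_charIdeal_eq_of_gvPar` (IS the main conjecture) | Greenberg Thm. 4.1; modularity; GZK | already main-conjecture level: `RowC7.bsdp` (Partition/Bsdp) |
| **C2** `r = 0` (BCS 2025 Cor. 1.3.1) | printed: BCS Thm. 1.1.2 (b) (integral MC under (im)) — NOT yet a tree fact (only part (a), `burungale_castella_skinner_charIdeal_eq_padicLFunction`); enters as `MazurMainConjecture W p` | Greenberg Thm. 4.1; modularity; GZK | `RowC2.bsdp_rankZero_of_mazurMainConjecture` |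
| **C6** `r = 0` (CGS 2025 Thm. D) | printed: CGS 2025 Thm. C ("CYC") — NOT yet a tree fact; enters as `MazurMainConjecture W p` | Greenberg Thm. 4.1; modularity; GZK | `RowC6.bsdp_rankZero_of_mazurMainConjecture` |
| **C16** `r = 0` (Yan–Zhu 2026, `p = 3`) | printed: Yan–Zhu Thm. 1.2 (MC at `p = 3`) — NOT yet a tree fact; enters as `MazurMainConjecture W 3` | Greenberg Thm. 4.1; modularity; GZK | `RowC16.bsdp_rankZero_of_mazurMainConjecture` |
| **C2 / C6 / C16** `r = 1` | `MazurMainConjecture W p` | as in row 2 — the CYCLOTOMIC skeleton modulo Schneider; NOT the printed route (printed: anticyclotomic / Heegner-point main conjecture + Gross–Zagier + Kolyvagin) | `RowC2/6/16.bsdp_rankOne_of_mazurMainConjecture_of_schneider` |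

Rows NOT bound at main-conjecture level here (no kernel skeleton of their printed route exists in
the tree; reported as gaps in HOME/b2b-bsdres-lit-glue/GLUE.md): C3 (Jetchev–Skinner–Wan 2017: BDP /
Heegner-point anticyclotomic main conjecture + anticyclotomic control + Gross–Zagier + Kolyvagin +
rank-0 twist — the X11b seats' `BDPRoute*` links (B)–(D) are typed at `p ‖ N` only), C8 / C10 / C17
(CM: Rubin's two-variable main conjecture + Coates–Wiles / Perrin-Riou–Bertrand / Kobayashi 2013
`p`-adic Gross–Zagier descent).

Nothing here is a Literature statement; no named fact is introduced; axioms standard.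
References: Skinner–Urban 2014 Thm. 3.6.9 / 3.6.11 and p. 46 [SkinnerUrban2014]; Skinner 2016 Thm. A/C,
§2.5, §3.2–3.3 [Skinner2016PacificMC]; Greenberg LNM 1716 Thm. 4.1 [GreenbergLNM1716]; Perrin-Riou 1987
§1.4 [PerrinRiou1987]; Balakrishnan–Müller–Stein 2016 Thm. 1.7 [BalakrishnanMullerStein2015];
Stein–Wuthrich 2013 Thm. 6.1 [SteinWuthrich2013]; Wuthrich 2014 Lemma 20 [Wuthrich2014];
Greenberg–Vatsal 2000 §3 [GreenbergVatsal2000]; Castella–Grossi–Lee–Skinner 2022 Thm. 5.1.4 (proof)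
[CastellaEtAl2021]; Burungale–Castella–Skinner 2025 Thm. 1.1.2, Cor. 1.3.1 [BurungaleCastellaSkinner2025];
Castella–Grossi–Skinner 2025 Thm. C/D [CastellaGrossiSkinner2025]; Yan–Zhu 2026 Thm. 1.2 / 4.15
[YanZhu2024MainConjNonCM]; Miller 2011 Def. 1.1 [Miller2011LMS]; RESIDUAL-CASES.md §a.1 (v35).
-/

set_option autoImplicit false

noncomputable section

open scoped Classical MatrixGroups ModularForm

open CongruenceSubgroup WeierstrassCurve Literature.NumberTheory.EllipticCurves
  Literature.NumberTheory.EllipticCurves.ModularForms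
  Literature.NumberTheory.EllipticCurves.Rank1Residual
  Literature.NumberTheory.EllipticCurves.Skinner2016
  Literature.NumberTheory.EllipticCurves.SteinWuthrich2013
  Summit.BirchSwinnertonDyer.BirchSwinnertonDyer.Theorems.Rank1ResidualX1Defs

namespace Summit.BirchSwinnertonDyer.Rank1Residual

section Curve

variable {W : WeierstrassCurve ℚ} [W.IsElliptic] [W.IsGloballyMinimal] {p : ℕ} [Fact p.Prime]

/-! ### §1. The universal skeletons at a good ordinary prime (any image of `ρ̄_{E,p}`) -/

/-- **Rank `0`, good ordinary odd `p`, ANY image: Mazur's main conjecture for `(E,p)` + Greenberg's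
control/Euler-characteristic theorem ⇒ `BSD(E,p)`.** Inputs by name: `hMC : MazurMainConjecture W p`
(the tree's `@[conjecture]` predicate: `X(E/ℚ_∞)` torsion, `char_Λ X = (g)`, `ι g = ϖ · L_p(f, α)`,
Néron normalisation — OPEN in general, a THEOREM on the loci of Skinner–Urban / Greenberg–Vatsal /
BCS / CGS), `hGr` = Greenberg, LNM 1716 (1999) Thm. 4.1 (named fact `greenberg_charValue_rankZero`),
modularity with an integral Manin constant (`hmod`), Gross–Zagier–Kolyvagin (`hGZK`); the
interpolation `L_p(E,0) = (1 - α⁻¹)² L(E,1)/Ω_E` is a tree theorem. The deduction is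
Castella–Grossi–Lee–Skinner 2022, proof of Thm. 5.1.4 (`Wuthrich2014.missingPPartAt_of_mainConjecture`
= `padicValRat_bsd_rank_zero_of_mazurMainConjecture` in Miller's currency), then
`Typed.bsdp_of_missingPPartAt`. [cite: CastellaEtAl2021, Thm. 5.1.4 (proof, §5.1.3)]
[cite: GreenbergLNM1716, Thm. 4.1 (p. 102)] [cite: Miller2011LMS, Def. 1.1] -/
theorem bsdp_of_mazurMainConjecture_of_analyticRank_eq_zero (hGr : greenberg_charValue_rankZero)
    (hmod : nonempty_modularParametrizationData)
    (hGZK : rank_eq_analyticRank_of_analyticRank_le_one)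
    (hp : p ≠ 2) (hord : GoodOrd W p) (hr0 : W.analyticRank = 0) (hMC : MazurMainConjecture W p) :
    BSDp W p :=
  Typed.bsdp_of_missingPPartAt W p hGZK (by omega)
    (Wuthrich2014.missingPPartAt_of_mainConjecture hGr hmod hGZK W p hp hord.1 hord.2
      (Literature.NumberTheory.EllipticCurves.Rank1Residual.entireLFunction_one_ne_zero_of_analyticRank_eq_zero
        hmod W hr0) hMC)

/-- **Rank `1`, good ordinary `p ≥ 5`, ANY image, MODULO the Schneider certificate: Mazur's main
conjecture for `(E,p)` + the Perrin-Riou–Schneider leading-term formula + Perrin-Riou's `p`-adic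
Gross–Zagier ⇒ `BSD(E,p)`.** Inputs by name: `hMC : MazurMainConjecture W p`; `hS` =
Perrin-Riou–Schneider as printed by Balakrishnan–Müller–Stein 2016 Thm. 1.7
(`Schneider1985_order_charGenerator`); `hPR` = Perrin-Riou 1987 §1.4 (`perrinRiou_rankOne_leadingTerms`);
modularity (`hmod`); GZK (`hGZK`); and the per-curve CERTIFICATE `hSch` — Schneider's non-degeneracy of
THE canonical cyclotomic `p`-adic height (open in general; a `p`-adic computation per curve). This is
the CYCLOTOMIC route (Perrin-Riou 1987 Cor. 1.8–1.9); the printed rank-one `p`-part theorems (JSW 2017,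
BCS 2025, CGS 2025) go through the anticyclotomic main conjecture instead and need no `hSch`.
Deduction: `Wuthrich2014.missingPPartAt_of_mainConjecture_of_rank_one`, then `Typed.bsdp_of_missingPPartAt`.
[cite: PerrinRiou1987, §1.4 Cor. 1.8] [cite: BalakrishnanMullerStein2015, Thm. 1.7]
[cite: Miller2011LMS, Def. 1.1] -/
theorem bsdp_of_mazurMainConjecture_of_analyticRank_eq_one_of_schneider
    (hS : Schneider1985_order_charGenerator) (hPR : perrinRiou_rankOne_leadingTerms)
    (hmod : nonempty_modularParametrizationData)
    (hGZK : rank_eq_analyticRank_of_analyticRank_le_one)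
    (hp : 5 ≤ p) (hord : GoodOrd W p) (hr1 : W.analyticRank = 1)
    (hSch : ∀ Dh : PAdicHeightData W p, Dh.IsCanonical → SchneiderConjecture Dh)
    (hMC : MazurMainConjecture W p) : BSDp W p :=
  Typed.bsdp_of_missingPPartAt W p hGZK (by omega)
    (Wuthrich2014.missingPPartAt_of_mainConjecture_of_rank_one hS hPR hmod hGZK W p hp hord.1 hord.2
      hr1 hSch hMC)

/-- **Rank `1`, good ordinary ODD `p` (so `p = 3` included), ANY image, MODULO the Schneider
certificate** — the odd-prime variant of `bsdp_of_mazurMainConjecture_of_analyticRank_eq_one_of_schneider`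
(facts `Schneider1985_order_charGenerator_odd`, `perrinRiou_rankOne_leadingTerms_odd`, and the
Mazur–Tate `p`-adic sigma function `mazur_tate_sigma_exists_odd` for the canonical height at `p = 3`).
Deduction: `Wuthrich2014.missingPPartAt_of_mainConjecture_of_rank_one_odd`.
[cite: PerrinRiou1987, §1.4 Cor. 1.8] [cite: BalakrishnanMullerStein2015, Thm. 1.7]
[cite: MazurTate1991, Thm. 3.1] [cite: Miller2011LMS, Def. 1.1] -/
theorem bsdp_of_mazurMainConjecture_of_analyticRank_eq_one_of_schneider_odd
    (hS : Schneider1985_order_charGenerator_odd) (hPR : perrinRiou_rankOne_leadingTerms_odd)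
    (hMT : mazur_tate_sigma_exists_odd) (hmod : nonempty_modularParametrizationData)
    (hGZK : rank_eq_analyticRank_of_analyticRank_le_one)
    (hp : p ≠ 2) (hord : GoodOrd W p) (hr1 : W.analyticRank = 1)
    (hSch : ∀ Dh : PAdicHeightData W p, Dh.IsCanonical → SchneiderConjecture Dh)
    (hMC : MazurMainConjecture W p) : BSDp W p :=
  Typed.bsdp_of_missingPPartAt W p hGZK (by omega)
    (Wuthrich2014.missingPPartAt_of_mainConjecture_of_rank_one_odd hS hPR hMT hmod hGZK W p hp
      hord.1 hord.2 hr1 hSch hMC)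

/-- **Analytic rank `≤ 1`, good ordinary odd `p`, ANY image: Mazur's main conjecture for `(E,p)` +
the typed control / leading-term theorems ⇒ `BSD(E,p)`, the Schneider certificate being asked only
in rank one.** Combination of the two skeletons above (`hr` split by `omega`).
[cite: GreenbergLNM1716, Thm. 4.1 (p. 102)] [cite: PerrinRiou1987, §1.4 Cor. 1.8]
[cite: Miller2011LMS, Def. 1.1] -/
theorem bsdp_of_mazurMainConjecture_of_analyticRank_le_one_of_schneider
    (hGr : greenberg_charValue_rankZero)
    (hS : Schneider1985_order_charGenerator_odd) (hPR : perrinRiou_rankOne_leadingTerms_odd)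
    (hMT : mazur_tate_sigma_exists_odd) (hmod : nonempty_modularParametrizationData)
    (hGZK : rank_eq_analyticRank_of_analyticRank_le_one)
    (hp : p ≠ 2) (hord : GoodOrd W p) (hr : W.analyticRank ≤ 1)
    (hSch : W.analyticRank = 1 → ∀ Dh : PAdicHeightData W p, Dh.IsCanonical → SchneiderConjecture Dh)
    (hMC : MazurMainConjecture W p) : BSDp W p := by
  rcases Nat.lt_or_ge W.analyticRank 1 with h0 | h1
  · exact bsdp_of_mazurMainConjecture_of_analyticRank_eq_zero hGr hmod hGZK hp hord (by omega) hMC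
  · have hr1 : W.analyticRank = 1 := le_antisymm hr h1
    exact bsdp_of_mazurMainConjecture_of_analyticRank_eq_one_of_schneider_odd hS hPR hMT hmod hGZK hp
      hord hr1 (hSch hr1) hMC

/-! ### §2. Adapter: Skinner 2016 Thm. A (typed) ⇒ the typed main conjecture at a multiplicative prime -/

/-- **Skinner 2016 Thm. A ⇒ `X2.MazurMainConjectureAt W p`** on its printed locus (`p ≥ 3`,
`p ‖ N`, (irr), (ram)): the named fact `Skinner2016.thmA_charIdeal_multiplicative` is, binder for
binder, the typed predicate `X2.MazurMainConjectureAt` (X2/Cells: the conclusion shape of Thm. A)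
except for the harmless guard `ϖ ≠ 0`, which holds because `Ω⁺_f > 0`
(`IsNewform0.plusPeriod_pos_holds`) and `Ω_E > 0`. [cite: Skinner2016PacificMC, Thm. A (§1) with §3.2–3.3] -/
theorem X2.mazurMainConjectureAt_of_thmA (hA : thmA_charIdeal_multiplicative) (hp : 3 ≤ p)
    (hmult : Mult W p) (hirr : Irr W p) (hram : Ram W p) : X2.MazurMainConjectureAt W p := by
  intro κ γ hκ hγ hγ' N _ f hf D ϖ hϖ
  have hϖ0 : ϖ ≠ 0 := by
    have hpos : 0 < plusPeriod f := IsNewform0.plusPeriod_pos_holds hf.1 hf.coeffField_eq_bot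
    rintro rfl
    simp only [Rat.cast_zero, zero_mul] at hϖ
    exact absurd hϖ hpos.ne
  exact hA W p hp hmult hirr hram hκ hγ hγ' hf D ϖ hϖ0 hϖ

/-- **Skinner–Urban 2014 Thm. 3.6.9 (integral clause) ⇒ the typed `MazurMainConjecture W p`** on
the GOOD locus of row C1: `p ≥ 3` good ordinary, (irr), (ram). Steps, all by name: (irr) + (ram) ⇒
`ρ̄_{E,p}` surjective (`surj_of_irr_of_ram`, Serre 1972 Prop. 15 + Tate); ⇒ `ρ̄_{E,p^n}` surjective
for all `n` (Serre's lifting lemma `serre_hasSurjectiveModNGaloisRep_pow_holds` for `p ≥ 5`;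
Wuthrich 2014 Lemma 20 `hW3` for `p = 3`); ⇒ S–U clause 3 (`hSU`, bsd.S21): `char_Λ X = (g)` with
`ι g = L_p(f, α)`; the period ratio `ϖ = Ω⁺_f/Ω_E` is a `p`-adic unit at a good irreducible odd `p`
(`h5`, `h3`: Greenberg–Vatsal 2000 §3 + Manin constant), so `g' := ϖ · g ∈ Λ` generates the same
ideal and `ι g' = ϖ · L_p(f, α)` — the Néron normalisation of `MazurMainConjecture`. So on this
locus the cell's `@[conjecture]` predicate is a THEOREM of the published record (S–U Thm. 3.6.9 as
printed: "If the image of `ρ_{E,p}` is surjective, then this equality holds in `Λ_ℚ`").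
[cite: SkinnerUrban2014, Thm. 3.6.9 (p. 45)] [cite: Serre1972, §2.4 Prop. 15; IV §3.4 (lifting)]
[cite: Wuthrich2014, Lemma 20 (p. 399)] [cite: GreenbergVatsal2000, §3, Remark 3.4] -/
theorem mazurMainConjecture_of_skinnerUrban
    (hSU : ∀ (W : WeierstrassCurve ℚ) [W.IsElliptic] [W.IsGloballyMinimal] (p : ℕ) [Fact p.Prime]
      (κ : ZpExtension ℚ p) (γ : Field.absoluteGaloisGroup ℚ) (N : ℕ) [NeZero N]
      (f : CuspForm (Gamma0 N) 2),
      skinner_urban_main_conjecture W p (κ := κ) (γ := γ) (f := f))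
    (hW3 : Wuthrich2014.lemma20_surjective_threeAdic_of_semistable)
    (h5 : realPeriodRat_eq_unit_mul_plusPeriod) (h3 : realPeriodRat_eq_unit_mul_plusPeriod_three)
    (hp : 3 ≤ p) (hord : GoodOrd W p) (hirr : Irr W p) (hram : Ram W p) :
    MazurMainConjecture W p := by
  intro κ γ hκ hγ hγ' _ f hf ϖ hϖ D
  have hpP : p.Prime := Fact.out
  have hsurj : Surj W p := surj_of_irr_of_ram W p hirr hram
  -- `p`-adic surjectivity
  have hsur : ∀ n : ℕ, W.HasSurjectiveModNGaloisRep (p ^ n : ℕ) := by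
    by_cases hp3 : p = 3
    · subst hp3
      exact hW3 W (Or.inl hord.1) hsurj
    · exact serre_hasSurjectiveModNGaloisRep_pow_holds W p
        (hpP.five_le_of_ne_two_of_ne_three (by omega) hp3) hsurj
  -- Skinner–Urban, clauses (1) and (3)
  obtain ⟨hX, -, hint⟩ := hSU W p κ γ _ f hp hord.1 hord.2 hirr hram hκ hγ hγ' hf D
  obtain ⟨g, hιg, hchar⟩ := hint hsur
  -- the period ratio is a `p`-adic unit
  have hv : padicValRat p ϖ = 0 :=
    periodUnit_of_realPeriodRat_eq_unit_mul_plusPeriod h5 h3 W p (by omega) hord.1 hirr f hf ϖ hϖ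
  have hϖ0 : ϖ ≠ 0 := by
    have hpos : 0 < plusPeriod f := IsNewform0.plusPeriod_pos_holds hf.1 hf.coeffField_eq_bot
    rintro rfl
    simp only [Rat.cast_zero, zero_mul] at hϖ
    exact absurd hϖ hpos.ne
  have hnorm : ‖((ϖ : ℚ) : ℚ_[p])‖ = 1 := by
    rw [Padic.eq_padicNorm, padicNorm.eq_zpow_of_nonzero hϖ0, hv]
    simp
  set u : ℤ_[p] := ⟨((ϖ : ℚ) : ℚ_[p]), hnorm.le⟩ with hu
  have hunit : IsUnit u := PadicInt.isUnit_iff.mpr hnorm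
  refine ⟨hX, PowerSeries.C u * g, ?_, ?_⟩
  · rw [hchar]
    exact (Ideal.span_singleton_mul_left_unit (hunit.map PowerSeries.C) g).symm
  · rw [map_mul, hιg, PowerSeries.map_C]
    rfl

/-! ### §3. The covered rows, bound one level deeper -/

/-- **C1 at main-conjecture level.** Skinner 2016 Thm. C (`r = 0`, `p ≥ 3` good ordinary or
multiplicative, (irr), (ram)) DERIVED in the kernel from the typed MAIN CONJECTURES and the typed
CONTROL theorems, every hypothesis an existing named fact:
* good ordinary branch — (irr) + (ram) ⇒ `ρ̄_{E,p}` surjective (`surj_of_irr_of_ram`: the ramified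
  multiplicative prime gives a transvection; Serre 1972 Prop. 15) ⇒ Skinner–Urban 2014 Thm. 3.6.9
  clause 3 (`hSU`, bsd.S21: the INTEGRAL equality `char_Λ X = (L_p)` for surjective `ρ_{E,p^∞}`,
  `p`-adic surjectivity by Serre (`p ≥ 5`, tree theorem) / Wuthrich 2014 Lemma 20 (`hW3`, `p = 3`))
  + Greenberg 1999 Thm. 4.1 (`hGr`) + the period unit `ord_p(Ω⁺_f/Ω_E) = 0` (`h5`, `h3`:
  Greenberg–Vatsal 2000 §3) ⇒ bsd.S30 (`padicValRat_bsd_rank_zero_of_mainConjecture`, S–U p. 46)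
  ⇒ `BSD(E,p)` (`bsdp_rankZero_of_S30`);
* multiplicative branch — Skinner 2016 Thm. A (`hA`) ⇒ `X2.MazurMainConjectureAt W p`
  (`X2.mazurMainConjectureAt_of_thmA`) + Jones 1989 / Stein–Wuthrich 2013 Thm. 6.1 (`hJs`, `hJn`) +
  Greenberg–Stevens (`hGS`) + `𝓛_p ≠ 0` ⇒ `BSD(E,p)`
  (x11a `X2.bsdp_of_mazurMainConjectureAt_of_analyticRank_eq_zero_heightFree`).
Modularity (`hmod`, `hpar`) and Gross–Zagier–Kolyvagin (`hGZK`) throughout. Compare `RowC1.bsdp`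
(Partition/Bsdp), which takes Thm. C itself as the named fact.
[cite: Skinner2016PacificMC, Thm. C, footnote 1, §2.5, Thm. A, §3.2–3.3]
[cite: SkinnerUrban2014, Thm. 3.6.9 (p. 45), proof of Thm. 3.6.11 (p. 46)]
[cite: GreenbergLNM1716, Thm. 4.1 (p. 102)] [cite: SteinWuthrich2013, Thm. 6.1 (p. 20)]
[cite: Wuthrich2014, Lemma 20 (p. 399)] [cite: GreenbergVatsal2000, §3, Remark 3.4] -/
theorem RowC1.bsdp_of_mainConjectures
    (hSU : ∀ (W : WeierstrassCurve ℚ) [W.IsElliptic] [W.IsGloballyMinimal] (p : ℕ) [Fact p.Prime]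
      (κ : ZpExtension ℚ p) (γ : Field.absoluteGaloisGroup ℚ) (N : ℕ) [NeZero N]
      (f : CuspForm (Gamma0 N) 2),
      skinner_urban_main_conjecture W p (κ := κ) (γ := γ) (f := f))
    (hA : thmA_charIdeal_multiplicative) (hGr : greenberg_charValue_rankZero)
    (hJs : thm61_splitMultiplicative) (hJn : thm61_nonsplitMultiplicative)
    (hGS : ∀ (W : WeierstrassCurve ℚ) [W.IsElliptic] [W.IsGloballyMinimal] (p : ℕ) [Fact p.Prime],
      greenberg_stevens (W := W) (p := p))
    (hW3 : Wuthrich2014.lemma20_surjective_threeAdic_of_semistable)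
    (h5 : realPeriodRat_eq_unit_mul_plusPeriod) (h3 : realPeriodRat_eq_unit_mul_plusPeriod_three)
    (hmod : hasEntireLFunction_rat) (hpar : nonempty_modularParametrizationData)
    (hGZK : rank_eq_analyticRank_of_analyticRank_le_one) (h : RowC1 W p) : BSDp W p := by
  obtain ⟨hr0, hp, hred, hirr, hram⟩ := h
  rcases hred with hord | hmult
  · -- good ordinary: (irr) + (ram) ⇒ surj ⇒ Skinner–Urban (integral, clause 3) ⇒ bsd.S30 ⇒ BSD(E,p)
    have hsurj : Surj W p := surj_of_irr_of_ram W p hirr hram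
    have hS30 : padicValRat_bsd_rank_zero :=
      padicValRat_bsd_rank_zero_of_mainConjecture hpar hSU
        (fun W _ _ hgood hsurj ↦ hW3 W (Or.inl hgood) hsurj) hGr
        (periodUnit_of_realPeriodRat_eq_unit_mul_plusPeriod h5 h3)
    exact bsdp_rankZero_of_S30 W p hS30 hmod hGZK hp hord hsurj hram hr0
  · -- multiplicative: Skinner Thm. A ⇒ the typed main conjecture at `p ‖ N` ⇒ BSD(E,p)
    exact X2.bsdp_of_mazurMainConjectureAt_of_analyticRank_eq_zero_heightFree hJs hJn hGZK hmod hpar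
      W p (hGS W p) (by omega) hmult hr0 (X2.mazurMainConjectureAt_of_thmA hA hp hmult hirr hram)

/-- **C2 ∩ {r = 0} at main-conjecture level** (Burungale–Castella–Skinner, IMRN 2025 Cor. 1.3.1:
non-CM, `p > 3` good ordinary, (irr), (im)). The printed proof takes `r = 0` from their INTEGRAL
main conjecture Thm. 1.1.2 (b) (under (im)); the tree types only the rational part (a)
(`burungale_castella_skinner_charIdeal_eq_padicLFunction`), so the main-conjecture input enters here
as the typed predicate `MazurMainConjecture W p`; the rest is the universal rank-`0` skeleton
(Greenberg Thm. 4.1 `hGr`, modularity, GZK). [cite: BurungaleCastellaSkinner2025, Cor. 1.3.1 (p. 4) and Thm. 1.1.2]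
[cite: GreenbergLNM1716, Thm. 4.1 (p. 102)] -/
theorem RowC2.bsdp_rankZero_of_mazurMainConjecture (hGr : greenberg_charValue_rankZero)
    (hmod : nonempty_modularParametrizationData)
    (hGZK : rank_eq_analyticRank_of_analyticRank_le_one) (h : RowC2 W p) (hr0 : W.analyticRank = 0)
    (hMC : MazurMainConjecture W p) : BSDp W p :=
  bsdp_of_mazurMainConjecture_of_analyticRank_eq_zero hGr hmod hGZK (by have := h.2.1; omega) h.2.2.1
    hr0 hMC

/-- **C2 ∩ {r = 1}: the CYCLOTOMIC skeleton modulo Schneider** (`p > 3`, so `p ≥ 5`): Mazur's main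
conjecture for `(E,p)` + Perrin-Riou–Schneider + Perrin-Riou 1987 + the Schneider certificate ⇒
`BSD(E,p)`. NOT the printed route (BCS's rank-one case is the Heegner-point / anticyclotomic
argument, which needs no `hSch`). [cite: BurungaleCastellaSkinner2025, Cor. 1.3.1 (p. 4)]
[cite: PerrinRiou1987, §1.4 Cor. 1.8] [cite: BalakrishnanMullerStein2015, Thm. 1.7] -/
theorem RowC2.bsdp_rankOne_of_mazurMainConjecture_of_schneider
    (hS : Schneider1985_order_charGenerator) (hPR : perrinRiou_rankOne_leadingTerms)
    (hmod : nonempty_modularParametrizationData)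
    (hGZK : rank_eq_analyticRank_of_analyticRank_le_one) (h : RowC2 W p) (hr1 : W.analyticRank = 1)
    (hSch : ∀ Dh : PAdicHeightData W p, Dh.IsCanonical → SchneiderConjecture Dh)
    (hMC : MazurMainConjecture W p) : BSDp W p :=
  bsdp_of_mazurMainConjecture_of_analyticRank_eq_one_of_schneider hS hPR hmod hGZK
    ((Fact.out : p.Prime).five_le_of_ne_two_of_ne_three (by have := h.2.1; omega)
      (by have := h.2.1; omega)) h.2.2.1 hr1 hSch hMC

/-- **C6 ∩ {r = 0} at main-conjecture level** (Castella–Grossi–Skinner, Math. Ann. 393 (2025)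
Thm. D: `p > 2` Eisenstein of good reduction off the anomalous line). The printed proof runs through
their cyclotomic main conjecture Thm. C ("CYC"); the tree types only Thm. D
(`CastellaGrossiSkinner2025.thmD_padicValRat_bsd_rank_le_one`), so the main-conjecture input enters
as `MazurMainConjecture W p`; a good Eisenstein prime `p > 2` is ordinary (`goodOrd_of_red_of_good`,
Serre 1972 §1.11); the rest is the universal rank-`0` skeleton. (On the GV-parity sub-locus the
main conjecture IS the named fact Greenberg–Vatsal 2000 Thm. 1.3: row C7, `RowC7.bsdp`.)
[cite: CastellaGrossiSkinner2025, Thm. C and Thm. D (= 'Thm. 4', proof p. 5)]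
[cite: GreenbergLNM1716, Thm. 4.1 (p. 102)] [cite: Serre1972, §1.11 Prop. 12] -/
theorem RowC6.bsdp_rankZero_of_mazurMainConjecture (hGr : greenberg_charValue_rankZero)
    (hmod : nonempty_modularParametrizationData)
    (hGZK : rank_eq_analyticRank_of_analyticRank_le_one) (h : RowC6 W p) (hr0 : W.analyticRank = 0)
    (hMC : MazurMainConjecture W p) : BSDp W p :=
  bsdp_of_mazurMainConjecture_of_analyticRank_eq_zero hGr hmod hGZK (by have := h.1; omega)
    (goodOrd_of_red_of_good W p h.1 h.2.2.1 h.2.1) hr0 hMC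

/-- **C6 ∩ {r = 1}: the CYCLOTOMIC skeleton modulo Schneider at an odd good Eisenstein prime**
(`p = 3` allowed). NOT the printed route (CGS's rank-one case goes through the anticyclotomic main
conjecture of Castella–Grossi–Lee–Skinner 2022). [cite: CastellaGrossiSkinner2025, Thm. D (= 'Thm. 4')]
[cite: PerrinRiou1987, §1.4 Cor. 1.8] [cite: BalakrishnanMullerStein2015, Thm. 1.7] -/
theorem RowC6.bsdp_rankOne_of_mazurMainConjecture_of_schneider
    (hS : Schneider1985_order_charGenerator_odd) (hPR : perrinRiou_rankOne_leadingTerms_odd)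
    (hMT : mazur_tate_sigma_exists_odd) (hmod : nonempty_modularParametrizationData)
    (hGZK : rank_eq_analyticRank_of_analyticRank_le_one) (h : RowC6 W p) (hr1 : W.analyticRank = 1)
    (hSch : ∀ Dh : PAdicHeightData W p, Dh.IsCanonical → SchneiderConjecture Dh)
    (hMC : MazurMainConjecture W p) : BSDp W p :=
  bsdp_of_mazurMainConjecture_of_analyticRank_eq_one_of_schneider_odd hS hPR hMT hmod hGZK
    (by have := h.1; omega) (goodOrd_of_red_of_good W p h.1 h.2.2.1 h.2.1) hr1 hSch hMC

/-- **C16 ∩ {r = 0} at main-conjecture level** (Yan–Zhu, J. Algebra 693 (2026) Thm. 4.15 at `p = 3`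
good ordinary irreducible with (Im)). The printed proof runs through their main conjecture at `p = 3`
(Beilinson–Flach); the tree types only Thm. 4.15 (`YanZhu2026.thm415_padicValRat_bsd_rank_le_one`), so
the main-conjecture input enters as `MazurMainConjecture W 3`; the rest is the universal rank-`0`
skeleton at the odd prime `3`. [cite: YanZhu2024MainConjNonCM, Thm. 4.15 (§4.6) and Thm. 1.2]
[cite: GreenbergLNM1716, Thm. 4.1 (p. 102)] -/
theorem RowC16.bsdp_rankZero_of_mazurMainConjecture (hGr : greenberg_charValue_rankZero)
    (hmod : nonempty_modularParametrizationData)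
    (hGZK : rank_eq_analyticRank_of_analyticRank_le_one) (h : RowC16 W p) (hr0 : W.analyticRank = 0)
    (hMC : MazurMainConjecture W p) : BSDp W p :=
  bsdp_of_mazurMainConjecture_of_analyticRank_eq_zero hGr hmod hGZK (by have := h.1; omega) h.2.1 hr0
    hMC

/-- **C16 ∩ {r = 1}: the CYCLOTOMIC skeleton modulo Schneider at `p = 3`** (odd-prime facts).
NOT the printed route. [cite: YanZhu2024MainConjNonCM, Thm. 4.15 (§4.6)]
[cite: PerrinRiou1987, §1.4 Cor. 1.8] [cite: BalakrishnanMullerStein2015, Thm. 1.7] -/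
theorem RowC16.bsdp_rankOne_of_mazurMainConjecture_of_schneider
    (hS : Schneider1985_order_charGenerator_odd) (hPR : perrinRiou_rankOne_leadingTerms_odd)
    (hMT : mazur_tate_sigma_exists_odd) (hmod : nonempty_modularParametrizationData)
    (hGZK : rank_eq_analyticRank_of_analyticRank_le_one) (h : RowC16 W p) (hr1 : W.analyticRank = 1)
    (hSch : ∀ Dh : PAdicHeightData W p, Dh.IsCanonical → SchneiderConjecture Dh)
    (hMC : MazurMainConjecture W p) : BSDp W p :=
  bsdp_of_mazurMainConjecture_of_analyticRank_eq_one_of_schneider_odd hS hPR hMT hmod hGZK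
    (by have := h.1; omega) h.2.1 hr1 hSch hMC

end Curve

end Summit.BirchSwinnertonDyer.Rank1Residual

end
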